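import Summits.ResolutionOfSingularities.ResolutionOfSingularities.Theses.HomologicalConductor
import Summits.ResolutionOfSingularities.ResolutionOfSingularities.Theorems.RankOneTermination.Negative.NonDiscreteMonomialValuation

/-!
# Crux `NoZeno` (stmt-ResolutionOfSingularities-16483) — the H-irr KERNEL DATUM in Lean:
# `(O, A) = (wtRing k, k[x⁻¹, y⁻¹])` on `K = k(x, y)`

Route `ResolutionOfSingularities/HomologicalConductor`, crux
`Summit.ResolutionOfSingularities.ResolutionOfSingularities.Theses.HomologicalConductor.NoZeno`,
line `birth`, open stub `stub_kernelRankOne`. Negative lane (`--supports` the crux item): a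
SMALL-MODEL fact, no Theses decl is asserted; OURS (res-L0-w44-tri-1, BARRIER & DEFECT triage —
the executable "second, disjoint check" of every idea card).

`wtRing k` (tree, `RankOneTermination/Negative/NonDiscreteMonomialValuation.lean`) is the monomial
valuation ring `x ↦ e`, `y ↦ e^{√2}` of `k(x,y)` at infinity: Krull dimension one, residue field
`k`, value group `ℤ + ℤ√2 ⊂ ℝ`, NOT noetherian. With the affine model `A = k[x⁻¹, y⁻¹] ⊆ O`
(section hypothesis `hA`) it is a datum of the crux over EVERY field `k` satisfying all tower-free side
conditions of the kernel stub (`hIrr_datum`): `k ⊆ O`, `A.FG`, `Frac A = K`, `A ⊆ O`, `O ≠ K`,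
`¬ IsNoetherianRing O`, RANK ONE in the stub's form `O ≤ O' → O' = O ∨ O' = K`
(`wtRing_rankOne`, from the archimedean value group), `trdeg_k K = 2`. Habitat: Abhyankar
(rational rank `2 = trdeg`, transcendence defect `0`) — the irrational-slope habitat H-irr of the
surface kernel (`surfaceKernel_exhausts`), disjoint from the DEFECT habitat (rational rank 1,
value group not finitely generated).

Kernel-only (axioms `propext`, `Classical.choice`, `Quot.sound`); no `def`, no named fact: the
model is a section variable `A` with `hA : A = Algebra.adjoin k (range fun i ↦ (X i)⁻¹)` (the
tree's `PlaneWitness` pattern), and `hIrr_datum` packages it as `∃ A, …`.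
-/

set_option linter.dupNamespace false

noncomputable section

open MvPolynomial

namespace Summit.ResolutionOfSingularities.ResolutionOfSingularities.Theorems.NoZeno.Negative

namespace HIrrDatum

open Summit.ResolutionOfSingularities.ResolutionOfSingularities.Theorems.RankOneTermination.Negative
open Summit.ResolutionOfSingularities.ResolutionOfSingularities.Theorems.RankOneTermination.Negative.MonomialValuation

variable (k : Type) [Field k]

/-- `v(1/x) < 1`, `v(1/y) < 1`: the inverted variables lie in the maximal ideal of `wtRing k`.
[folklore] -/
theorem wtVal_inv_X_lt_one (i : Fin 2) : wtVal k (algebraMap (Pol k) (RatF k) (X i))⁻¹ < 1 := by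
  rw [map_inv₀, wtVal_X]
  exact inv_lt_one_of_one_lt₀ (one_lt_expWt_single i)

/-- `1/x, 1/y ∈ wtRing k`. [folklore] -/
theorem inv_X_mem_wtRing (i : Fin 2) : (algebraMap (Pol k) (RatF k) (X i))⁻¹ ∈ wtRing k :=
  (wtVal_inv_X_lt_one k i).le

/-- `x, y ∉ wtRing k` (value `> 1`). [folklore] -/
theorem X_not_mem_wtRing (i : Fin 2) : algebraMap (Pol k) (RatF k) (X i) ∉ wtRing k := by
  rw [mem_wtRing_iff, not_le, wtVal_X]
  exact one_lt_expWt_single i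

/-- `wtRing k ≠ K` (it omits `x`; the kernel's `O ≠ ⊤`). [folklore] -/
theorem wtRing_ne_top : wtRing k ≠ ⊤ := by
  intro h
  have : algebraMap (Pol k) (RatF k) (X 0) ∈ wtRing k := by
    rw [h]; exact ValuationSubring.mem_top _
  exact X_not_mem_wtRing k 0 this

/-- **Rank one** in the kernel stub's form: no valuation ring strictly between `wtRing k` and `K`
(the value group is archimedean: `v t < (v s)^n` for some `n` when `v s > 1`). [folklore] -/
theorem wtRing_rankOne (O' : ValuationSubring (RatF k)) (h : wtRing k ≤ O') :
    O' = wtRing k ∨ O' = ⊤ := by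
  by_cases h' : O' ≤ wtRing k
  · exact Or.inl (le_antisymm h' h)
  · right
    obtain ⟨s, hsO', hs⟩ := Set.not_subset.mp h'
    have hs1 : 1 < wtVal k s := by
      rw [SetLike.mem_coe, mem_wtRing_iff, not_le] at hs; exact hs
    have hs0 : s ≠ 0 := by
      rintro rfl; rw [map_zero] at hs1; exact absurd hs1 (not_lt.mpr zero_le_one)
    rw [eq_top_iff]
    intro t _
    by_cases ht : wtVal k t ≤ 1
    · exact h ht
    · obtain ⟨n, hn⟩ := pow_unbounded_of_one_lt (wtVal k t) hs1
      have hsn0 : s ^ n ≠ 0 := pow_ne_zero _ hs0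
      have hu : t / s ^ n ∈ wtRing k := by
        rw [mem_wtRing_iff, map_div₀, map_pow]
        have hpos : 0 < wtVal k s ^ n := pow_pos (lt_trans zero_lt_one hs1) n
        rw [div_le_one hpos]
        exact hn.le
      have : t = t / s ^ n * s ^ n := by rw [div_mul_cancel₀ t hsn0]
      rw [this]
      exact mul_mem (h hu) (pow_mem hsO' n)

/-- `trdeg_k k(x,y) = 2`. [folklore] -/
theorem trdeg_RatF : Algebra.trdeg k (RatF k) = 2 := by
  haveI : Algebra.IsAlgebraic (Pol k) (RatF k) :=
    IsLocalization.isAlgebraic _ (nonZeroDivisors (Pol k))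
  have h := trdeg_add_eq k (Pol k) (A := RatF k)
  rw [trdeg_eq_zero (R := Pol k) (A := RatF k), add_zero, MvPolynomial.trdeg_of_isDomain] at h
  simpa using h.symm

/-- powers cancel: `x^d * (x⁻¹)^a = (x⁻¹)^(a-d)` for `d ≤ a`. [folklore] -/
theorem pow_mul_inv_pow {x : RatF k} (hx : x ≠ 0) {d a : ℕ} (h : d ≤ a) :
    x ^ d * x⁻¹ ^ a = x⁻¹ ^ (a - d) := by
  obtain ⟨c, rfl⟩ := Nat.exists_eq_add_of_le h
  rw [pow_add, ← mul_assoc, ← mul_pow, mul_inv_cancel₀ hx, one_pow, one_mul,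
    Nat.add_sub_cancel_left]

section Model

/-! ## The affine model `A = k[x⁻¹, y⁻¹]` (section hypothesis `hA`) -/

variable (A : Subalgebra k (RatF k))
  (hA : A = Algebra.adjoin k (Set.range fun i : Fin 2 => (algebraMap (Pol k) (RatF k) (X i))⁻¹))

include hA

/-- `k[x⁻¹, y⁻¹]` is a finitely generated `k`-algebra (the binder `hA` of the crux). [folklore] -/
theorem model_fg : A.FG :=
  ⟨(Set.finite_range _).toFinset, by rw [Set.Finite.coe_toFinset, hA]⟩

/-- `1/x, 1/y ∈ k[x⁻¹, y⁻¹]`. [folklore] -/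
theorem inv_X_mem_model (i : Fin 2) : (algebraMap (Pol k) (RatF k) (X i))⁻¹ ∈ A := by
  rw [hA]
  exact Algebra.subset_adjoin ⟨i, rfl⟩

/-- `k[x⁻¹, y⁻¹] ⊆ wtRing k` as subrings (the binder `hAO` of the crux). [folklore] -/
theorem model_le : A.toSubring ≤ (wtRing k).toSubring := by
  let S : Subalgebra k (RatF k) :=
    { (wtRing k).toSubring with algebraMap_mem' := fun c => algebraMap_mem_wtRing k c }
  have hS : A ≤ S := by
    rw [hA]
    refine Algebra.adjoin_le ?_
    rintro z ⟨i, rfl⟩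
    exact inv_X_mem_wtRing k i
  exact fun _ hz => hS hz

/-- a polynomial times a large inverse monomial lies in `k[x⁻¹, y⁻¹]` [folklore] -/
theorem poly_mul_mem_model (P : Pol k) {a b : ℕ} (ha : P.degreeOf 0 ≤ a)
    (hb : P.degreeOf 1 ≤ b) :
    algebraMap (Pol k) (RatF k) P * ((algebraMap (Pol k) (RatF k) (X 0))⁻¹ ^ a *
      (algebraMap (Pol k) (RatF k) (X 1))⁻¹ ^ b) ∈ A := by
  classical
  rw [P.as_sum, map_sum, Finset.sum_mul]
  refine Subalgebra.sum_mem _ fun d hd => ?_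
  have hd0 : d 0 ≤ a := (monomial_le_degreeOf 0 hd).trans ha
  have hd1 : d 1 ≤ b := (monomial_le_degreeOf 1 hd).trans hb
  have hmon : monomial d (coeff d P) = C (coeff d P) * X 0 ^ d 0 * X 1 ^ d 1 := by
    rw [monomial_eq, Finsupp.prod_fintype _ _ (fun i => by simp), Fin.prod_univ_two, mul_assoc]
  rw [hmon, map_mul, map_mul, map_pow, map_pow]
  have hC : algebraMap (Pol k) (RatF k) (C (coeff d P)) = algebraMap k (RatF k) (coeff d P) := by
    rw [← MvPolynomial.algebraMap_eq, ← IsScalarTower.algebraMap_apply]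
  rw [hC]
  set x := algebraMap (Pol k) (RatF k) (X 0)
  set y := algebraMap (Pol k) (RatF k) (X 1)
  have : algebraMap k (RatF k) (coeff d P) * x ^ d 0 * y ^ d 1 * (x⁻¹ ^ a * y⁻¹ ^ b)
      = algebraMap k (RatF k) (coeff d P) * ((x ^ d 0 * x⁻¹ ^ a) * (y ^ d 1 * y⁻¹ ^ b)) := by
    ring
  rw [this, pow_mul_inv_pow k (algebraMap_X_ne_zero k 0) hd0, pow_mul_inv_pow k (algebraMap_X_ne_zero k 1) hd1]
  refine Subalgebra.mul_mem _ (Subalgebra.algebraMap_mem _ _) (Subalgebra.mul_mem _ ?_ ?_)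
  · exact Subalgebra.pow_mem _ (inv_X_mem_model k A hA 0) _
  · exact Subalgebra.pow_mem _ (inv_X_mem_model k A hA 1) _

/-- `Frac k[x⁻¹, y⁻¹] = k(x,y)` (the binder `hfr` of the crux). [folklore] -/
theorem model_isFractionRing : IsFractionRing A (RatF k) := by
  refine IsFractionRing.of_field A _ fun z => ?_
  obtain ⟨P, Q, -, rfl⟩ := IsFractionRing.div_surjective (A := Pol k) z
  set a : ℕ := P.degreeOf 0 + Q.degreeOf 0
  set b : ℕ := P.degreeOf 1 + Q.degreeOf 1
  set M : RatF k := (algebraMap (Pol k) (RatF k) (X 0))⁻¹ ^ a *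
    (algebraMap (Pol k) (RatF k) (X 1))⁻¹ ^ b
  have hM : M ≠ 0 := mul_ne_zero (pow_ne_zero _ (inv_ne_zero (algebraMap_X_ne_zero k 0)))
    (pow_ne_zero _ (inv_ne_zero (algebraMap_X_ne_zero k 1)))
  refine ⟨⟨_, poly_mul_mem_model k A hA P (a := a) (b := b) (by omega) (by omega)⟩,
    ⟨_, poly_mul_mem_model k A hA Q (a := a) (b := b) (by omega) (by omega)⟩, ?_⟩
  change _ = algebraMap (Pol k) (RatF k) P * M / (algebraMap (Pol k) (RatF k) Q * M)
  rw [mul_div_mul_right _ _ hM]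

end Model

/-- **H-irr kernel datum.** Over every field `k`, the rank-one non-noetherian valuation ring
`O = wtRing k` of `K = k(x,y)` together with the affine model `A = k[x⁻¹, y⁻¹]` satisfies all
tower-free hypotheses of the `NoZeno` datum (`hk`, `hA`, `hfr`, `hAO`) and of the kernel stub
`stub_kernelRankOne` (`O ≠ ⊤`, `¬ IsNoetherianRing O`, rank one, `trdeg = 2`). [folklore] -/
theorem hIrr_datum : ∃ A : Subalgebra k (RatF k),
    (∀ c : k, algebraMap k (RatF k) c ∈ wtRing k) ∧ A.FG ∧ IsFractionRing A (RatF k) ∧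
    A.toSubring ≤ (wtRing k).toSubring ∧ wtRing k ≠ ⊤ ∧ ¬ IsNoetherianRing (wtRing k) ∧
    (∀ O' : ValuationSubring (RatF k), wtRing k ≤ O' → O' = wtRing k ∨ O' = ⊤) ∧
    Algebra.trdeg k (RatF k) = 2 :=
  ⟨_, algebraMap_mem_wtRing k, model_fg k _ rfl, model_isFractionRing k _ rfl, model_le k _ rfl,
    wtRing_ne_top k, not_isNoetherianRing_wtRing k, wtRing_rankOne k, trdeg_RatF k⟩

end HIrrDatum

end Summit.ResolutionOfSingularities.ResolutionOfSingularities.Theorems.NoZeno.Negative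

end
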